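import Summits.NavierStokesRegularity.NavierStokesRegularity.Theorems.AdaptedFrequencyFrequencyRigidityRSSWitnessDecays
import Summits.NavierStokesRegularity.NavierStokesRegularity.Theorems.AdaptedFrequencyFrequencyRigidityFiniteABDilation
import HarnessLib

/-!
# Crux `FrequencyRigidity` (stmt-NavierStokesRegularity-2955), line `scaled-energy-split`:
# RSS witnesses of the finite child in Albritton–Barker form (Stub 2′) have decaying profiles

Helper file (`--supports stmt-NavierStokesRegularity-2955`; theorems only, sorry-free).

Stub 2′ of the line (`stub_finiteScaledEnergyLiouvilleAB`) forbids a flat inhabitant of the crux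
body — a classical ancient Navier–Stokes flow `(v, q)` with viscosity `ν > 0` on `ℝ³ × (−∞, 0)` —
lying in the Albritton–Barker class: SOME suitable pressure `ϖ` (`IsSuitableWeakSolutionOn` on the
open backward slab, Caffarelli–Kohn–Nirenberg 1982, (2.1)–(2.5)) and weak spatial gradient `G'`
with finite Albritton–Barker quantity `𝐈 = 𝐈(ℝ³ × ℝ₋; v, ϖ, G')`
(`typeIBound (Iio 0 ×ˢ univ) v ϖ G' < ⊤`).  This file ports sub-goal (H) of the classical-form
Stub 2 (`stub_rssWitnessDecays`, lead c7: pressure `q`, gradient `fderiv`) to the A–B form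
(registered stub `finiteAB_rssWitnessDecays`): every ROTATED SELF-SIMILAR witness
`v = pvAnsatz α U` (Pineau–Vicol 2026 (1.7)) of Stub 2′ has a profile with Pineau–Vicol's decay
`‖U(y)‖ ≤ C₀/(1 + ‖y‖)` — so the restated crux keeps its RSS dictionary: together with lead
c7's window theorem `stub_rssWitnessWindow` (Pineau–Vicol 2026 Thm 1.4; it involves neither the
pressure nor `𝐈`, so it serves the A–B form verbatim and is not restated here) the RSS content of
Stub 2′ is Pineau–Vicol's Conjecture 1.1 on its window.

Proof.  In the A–B form the only place where `𝐈 < ∞` enters — "the top singular set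
`{x ∈ B(0,1) : (0, x) backward-singular}` of the unit backward parabolic ball is `μH[1]`-null"
(Tsai 1998, Lemma 4.2 and the remark after it, tree theorem `tsai1998_top_singular_null_holds`
over the slab packaging `isLocalTypeISingularPoint_of_slabProfile`) — is a statement about
SUITABLE weak solutions, so the given triple `(v, ϖ, G')` is fed to it directly
(`finiteAB_rssDecay_topSingular_null`); the classical ⇒ suitable step of the classical form
(`stub_classicalSuitableSlab`) disappears.  Everything else is c7's spiral argument verbatim, which
uses only the classical flow `v = pvAnsatz α U`: if `‖yₖ‖‖U(yₖ)‖ → ∞` the rotated directions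
accumulate at a unit vector `e` and every point of the spiral `σ ↦ σ R(−2α log σ) e`, `0 < σ < 1`,
is backward-singular at `t = 0` (`rssDecay_spiral_singular`), a set of `μH[1]`-measure `≥ 1`
(`rssDecay_one_le_hausdorffMeasure_spiral`) — contradiction; continuity of `U = v(−1, ·)` then
gives the decay (`rssDecay_profile_continuous`, `rssDecay_decay_of_bound`).  General viscosity:
the normalisation `u(t, x) = ν⁻¹ v(ν⁻¹ t, x)` is classical with unit viscosity
(`classical_viscosity`), RSS with the profile `Ũ(y) = (√ν)⁻¹ R(α log ν) U(√ν R(−α log ν) y)`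
(`stub_rssViscosityNormalisation`), and its A–B clause is the time-dilated one
(`finiteAB_abClause_dilate` with `β = ν⁻¹`); the decay of `Ũ` is the decay of `U`
(`rssWitness_decay_of_normalised`).

## References

* T.-P. Tsai, *On Leray's self-similar solutions of the Navier–Stokes equations satisfying local
  energy estimates*, Arch. Rational Mech. Anal. 143 (1998) 29–51: Lemma 4.2 and the remark after
  it, Corollary 4.3 (pp. 46–47). [Tsai1998]
* B. Pineau, V. Vicol, arXiv:2607.09619 (2026), (1.7), (1.9)–(1.10), Remark 1.2, Theorem 1.4.
  [PineauVicol2026]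
* D. Albritton, T. Barker, J. Math. Fluid Mech. 21 (2019) = arXiv:1811.00502, §1, Def. 2.1.
  [AlbrittonBarker2019]
-/

noncomputable section

-- the registered stub namespace repeats the summit name `NavierStokesRegularity` (summit = problem)
set_option linter.dupNamespace false

namespace Summit.NavierStokesRegularity.NavierStokesRegularity.Theorems

open Literature.Analysis.FluidPDE MeasureTheory Set Function Metric Filter Topology
open Summit.NavierStokesRegularity.NavierStokesRegularity.Theorems.FrequencyRigidity.ScaledEnergySplit
open scoped ENNReal NNReal

variable {α : ℝ} {U : EuclideanSpace ℝ (Fin 3) → EuclideanSpace ℝ (Fin 3)}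
  {u : ℝ → EuclideanSpace ℝ (Fin 3) → EuclideanSpace ℝ (Fin 3)}
  {p ϖ : ℝ → EuclideanSpace ℝ (Fin 3) → ℝ}
  {G : ℝ → EuclideanSpace ℝ (Fin 3) → EuclideanSpace ℝ (Fin 3) →L[ℝ] EuclideanSpace ℝ (Fin 3)}

/-! ## The top singular set of a finite-`𝐈` suitable slab profile is `μH[1]`-null -/

/-- **Tsai's Lemma 4.2 remark for suitable slab profiles with `𝐈 < ∞` and a singular vertex
(Albritton–Barker form).**  A suitable weak solution `(u, ϖ)` (`ν = 1`) on the slab `ℝ³ × (−∞,0)`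
with a weak spatial gradient `G`, finite Albritton–Barker quantity `𝐈(ℝ³ × ℝ₋; u, ϖ, G)` and a
backward-singular origin is, with the pressure normalised by its unit-ball mean, a local Type I
singular point (`isLocalTypeISingularPoint_of_slabProfile`), in particular a suitable weak solution
in `Q((0,0),1)` in CKN's class on the whole ball; hence the set of `x ∈ B(0,1)` with `(0,x)`
backward-singular is `μH[1]`-null (`tsai1998_top_singular_null_holds`).
[cite: Tsai1998, Lemma 4.2 and the following remark (p. 46)] -/
theorem finiteAB_rssDecay_topSingular_null
    (hsw : IsSuitableWeakSolutionOn (slab (EuclideanSpace ℝ (Fin 3)) (Iio (0 : ℝ)) isOpen_Iio) 1 0 u ϖ)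
    (hwg : HasWeakSpatialGradientOn (slab (EuclideanSpace ℝ (Fin 3)) (Iio (0 : ℝ)) isOpen_Iio) u G)
    (hI : typeIBound (Iio (0 : ℝ) ×ˢ univ) u ϖ G < ⊤)
    (hsing : IsBackwardSingularPoint u 0) :
    μH[1] {x ∈ ball (0 : EuclideanSpace ℝ (Fin 3)) 1 | IsBackwardSingularPoint u (0, x)} = 0 := by
  -- adapted from `rssDecay_topSingular_null` (lead c7): the suitable triple is now given
  obtain ⟨-, ⟨hswQ, ⟨C, hC⟩, hgrad, hp'⟩, -, -⟩ :=
    isLocalTypeISingularPoint_of_slabProfile hsw hwg hI hsing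
  obtain ⟨h32, h32', h32r⟩ := threeHalves_facts
  have hfin := hp'.eLpNorm_lt_top
  rw [eLpNorm_eq_lintegral_rpow_enorm_toReal (zero_lt_one.trans_le h32).ne' h32', h32r] at hfin
  have hp : ∫⁻ z in parabolicCylinder 1 (0 : ℝ × EuclideanSpace ℝ (Fin 3)),
      ‖(fun t x => ϖ t x - ⨍ y in ball (0 : EuclideanSpace ℝ (Fin 3)) 1, ϖ t y) z.1 z.2‖ₑ
        ^ (3 / 2 : ℝ) < ∞ :=
    (ENNReal.rpow_lt_top_iff_of_pos (by norm_num : (0:ℝ) < 1 / (3 / 2))).1 hfin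
  have henergy : ∃ C : ℝ≥0, ∀ᵐ t : ℝ, t ∈ Ioo ((0:ℝ) - 1 ^ 2) 0 →
      ∫⁻ x in ball (0 : EuclideanSpace ℝ (Fin 3)) 1, ‖u t x‖ₑ ^ 2 ≤ C := by
    refine ⟨C, ?_⟩
    have hC' : ∀ᵐ t ∂(volume.restrict (Ioo ((0:ℝ) - 1 ^ 2) 0)),
        ∫⁻ x in ball (0 : EuclideanSpace ℝ (Fin 3)) 1, ‖u t x‖ₑ ^ 2 ≤ C := by
      simpa using hC
    exact (ae_restrict_iff' measurableSet_Ioo).1 hC'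
  exact tsai1998_top_singular_null_holds one_pos one_pos hswQ henergy hgrad hp

/-! ## Decay of the profile, unit viscosity -/

/-- **Tsai's Corollary 4.3 for rotated self-similar flows in the Albritton–Barker class (suitable
triple given)**: the profile satisfies `‖y‖‖U(y)‖ ≤ C` for `‖y‖ ≥ R`.  Otherwise the spiral of
singular top points built from a non-decay sequence (`rssDecay_spiral_singular`) has positive
`μH[1]`-measure (`rssDecay_one_le_hausdorffMeasure_spiral`) inside the `μH[1]`-null top singular
set of the unit parabolic ball (`finiteAB_rssDecay_topSingular_null`, the vertex being singular by
`rssDecay_origin_singular`). [cite: Tsai1998, Corollary 4.3 (pp. 46–47)] -/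
theorem finiteAB_rssDecay_exists_bound (hsol : IsClassicalNSSolutionOn (Iio (0 : ℝ)) 1 0 u p)
    (hA : ∀ t ∈ Iio (0 : ℝ), ∀ x, u t x = pvAnsatz α (fun z _ => U z) t x)
    (hsw : IsSuitableWeakSolutionOn (slab (EuclideanSpace ℝ (Fin 3)) (Iio (0 : ℝ)) isOpen_Iio) 1 0 u ϖ)
    (hwg : HasWeakSpatialGradientOn (slab (EuclideanSpace ℝ (Fin 3)) (Iio (0 : ℝ)) isOpen_Iio) u G)
    (hI : typeIBound (Iio (0 : ℝ) ×ˢ univ) u ϖ G < ⊤) :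
    ∃ C R : ℝ, ∀ y, R ≤ ‖y‖ → ‖y‖ * ‖U y‖ ≤ C := by
  -- adapted from `rssDecay_exists_bound` (lead c7): only the null-set step changes
  by_contra hcon
  push Not at hcon
  choose y hyR hyC using fun k : ℕ => hcon k (k + 1)
  have hy0 : ∀ k, 0 < ‖y k‖ := fun k => lt_of_lt_of_le (by positivity) (hyR k)
  have hy0' : ∀ k, y k ≠ 0 := fun k => norm_pos_iff.1 (hy0 k)
  -- the profile is not identically zero, so the vertex is singular and Tsai's lemma applies
  have hU0 : U (y 0) ≠ 0 := by
    intro h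
    have := hyC 0
    rw [h, norm_zero, mul_zero] at this
    exact absurd this (by norm_num)
  have hnull := finiteAB_rssDecay_topSingular_null hsw hwg hI (rssDecay_origin_singular hsol hA hU0)
  -- rotated directions accumulate on the unit sphere
  have hd1 : ∀ k, rotZ (2 * α * Real.log ‖y k‖) (‖y k‖⁻¹ • y k) ∈
      sphere (0 : EuclideanSpace ℝ (Fin 3)) 1 := by
    intro k
    rw [mem_sphere_zero_iff_norm, norm_rotZ]
    exact norm_smul_inv_norm (hy0' k)
  obtain ⟨e, he, φ, hφ, hlim⟩ :=
    (isCompact_sphere (0 : EuclideanSpace ℝ (Fin 3)) 1).tendsto_subseq hd1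
  have he1 : ‖e‖ = 1 := mem_sphere_zero_iff_norm.1 he
  have hnorm : Tendsto (fun n => ‖y (φ n)‖) atTop atTop := by
    refine tendsto_atTop_mono (fun n => ?_) tendsto_natCast_atTop_atTop
    calc (n : ℝ) ≤ φ n := Nat.cast_le.2 (hφ.id_le n)
      _ ≤ φ n + 1 := by linarith
      _ ≤ ‖y (φ n)‖ := hyR (φ n)
  have hyC' : ∀ n : ℕ, (n : ℝ) < ‖y (φ n)‖ * ‖U (y (φ n))‖ := fun n =>
    lt_of_le_of_lt (Nat.cast_le.2 (hφ.id_le n)) (hyC (φ n))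
  -- every point of the spiral is a singular top point inside `B(0,1)`
  have hsub : (fun σ : ℝ => σ • rotZ (-(2 * α * Real.log σ)) e) '' Ioo (0 : ℝ) 1 ⊆
      {x ∈ ball (0 : EuclideanSpace ℝ (Fin 3)) 1 | IsBackwardSingularPoint u (0, x)} := by
    rintro _ ⟨σ, hσ, rfl⟩
    refine ⟨?_, rssDecay_spiral_singular hsol hA (fun n => hy0' (φ n)) hnorm hyC' hlim hσ.1⟩
    rw [mem_ball_zero_iff, norm_smul, norm_rotZ, Real.norm_of_nonneg hσ.1.le, he1, mul_one]
    exact hσ.2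
  have hle := (rssDecay_one_le_hausdorffMeasure_spiral α he1).trans
    (measure_mono (μ := μH[1]) hsub)
  rw [hnull] at hle
  exact absurd hle (by norm_num)

/-- **Unit-viscosity form of stub `finiteAB_rssWitnessDecays`.**  A classical unit-viscosity
Navier–Stokes flow on `(−∞,0)` of rotated self-similar form `u = pvAnsatz α U` which is also a
suitable weak solution on the slab for some pressure `ϖ`, with a weak gradient `G` and
`𝐈(ℝ³ × ℝ₋; u, ϖ, G) < ∞`, has `‖U(y)‖ ≤ C₀/(1 + ‖y‖)` for some `C₀ > 0`
(`finiteAB_rssDecay_exists_bound`, continuity of `U = u(−1, ·)`).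
[cite: Tsai1998, Corollary 4.3 (pp. 46–47); PineauVicol2026, Remark 1.2] -/
theorem finiteAB_rssWitnessDecays_unit (hsol : IsClassicalNSSolutionOn (Iio (0 : ℝ)) 1 0 u p)
    (hA : ∀ t ∈ Iio (0 : ℝ), ∀ x, u t x = pvAnsatz α (fun z _ => U z) t x)
    (hsw : IsSuitableWeakSolutionOn (slab (EuclideanSpace ℝ (Fin 3)) (Iio (0 : ℝ)) isOpen_Iio) 1 0 u ϖ)
    (hwg : HasWeakSpatialGradientOn (slab (EuclideanSpace ℝ (Fin 3)) (Iio (0 : ℝ)) isOpen_Iio) u G)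
    (hI : typeIBound (Iio (0 : ℝ) ×ˢ univ) u ϖ G < ⊤) :
    ∃ C₀ : ℝ, 0 < C₀ ∧ ∀ y, ‖U y‖ ≤ C₀ / (1 + ‖y‖) := by
  obtain ⟨C, R, h⟩ := finiteAB_rssDecay_exists_bound hsol hA hsw hwg hI
  exact rssDecay_decay_of_bound (rssDecay_profile_continuous hsol hA) h

/-! ## Registered stub: any viscosity -/

/-- **Stub `finiteAB_rssWitnessDecays` of line `scaled-energy-split` — RSS witnesses of the finite
child in Albritton–Barker form (Stub 2′) have Pineau–Vicol-decaying profiles, for every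
viscosity.**  A classical viscosity-`ν` Navier–Stokes flow `(v, q)` on `(−∞,0)` of rotated
self-similar form `v = pvAnsatz α U` that is a suitable weak solution on the open backward slab for
some pressure `ϖ`, with a weak spatial gradient `G'` and finite Albritton–Barker quantity
`𝐈(ℝ³ × ℝ₋; v, ϖ, G') < ∞`, has `‖U(y)‖ ≤ C₀/(1 + ‖y‖)` for some `C₀ > 0`.  Unit viscosity:
`finiteAB_rssWitnessDecays_unit` (Tsai 1998 §4 on spirals, the `𝐈`-hypothesis consumed by the
suitable triple directly); general `ν` by the viscosity normalisation `u = ν⁻¹ v(ν⁻¹ ·, ·)`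
(`classical_viscosity`, `stub_rssViscosityNormalisation`, `finiteAB_abClause_dilate` with
`β = ν⁻¹`, `rssWitness_decay_of_normalised`).
[cite: Tsai1998, Corollary 4.3 (pp. 46–47); PineauVicol2026, Remark 1.2] -/
theorem finiteAB_rssWitnessDecays : ∀ (ν α : ℝ) (U : EuclideanSpace ℝ (Fin 3) → EuclideanSpace ℝ (Fin 3)) (v : ℝ → EuclideanSpace ℝ (Fin 3) → EuclideanSpace ℝ (Fin 3)) (q : ℝ → EuclideanSpace ℝ (Fin 3) → ℝ) (ϖ : ℝ → EuclideanSpace ℝ (Fin 3) → ℝ) (G' : ℝ → EuclideanSpace ℝ (Fin 3) → EuclideanSpace ℝ (Fin 3) →L[ℝ] EuclideanSpace ℝ (Fin 3)), 0 < ν → Literature.Analysis.FluidPDE.IsClassicalNSSolutionOn (Set.Iio 0) ν 0 v q → (∀ t ∈ Set.Iio (0:ℝ), ∀ x, v t x = Literature.Analysis.FluidPDE.pvAnsatz α (fun y _ => U y) t x) → Literature.Analysis.FluidPDE.IsSuitableWeakSolutionOn (Literature.Analysis.FluidPDE.slab (EuclideanSpace ℝ (Fin 3)) (Set.Iio 0)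 isOpen_Iio) ν 0 v ϖ → Literature.Analysis.FluidPDE.HasWeakSpatialGradientOn (Literature.Analysis.FluidPDE.slab (EuclideanSpace ℝ (Fin 3)) (Set.Iio 0) isOpen_Iio) v G' → Literature.Analysis.FluidPDE.typeIBound (Set.Iio (0:ℝ) ×ˢ Set.univ) v ϖ G' < ⊤ → ∃ C₀ : ℝ, 0 < C₀ ∧ ∀ y, ‖U y‖ ≤ C₀ / (1 + ‖y‖) := by
  intro ν α U v q ϖ G' hν hsol hA hsw hwg hI
  -- the normalised pair `(ν⁻¹ v(ν⁻¹ ·, ·), ν⁻² q(ν⁻¹ ·, ·))` is classical with unit viscosity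
  have hcl := classical_viscosity hν hsol
  -- its Albritton–Barker clause is the time-dilated one, `β = ν⁻¹`
  obtain ⟨hsw1, hwg1, hI1⟩ :=
    finiteAB_abClause_dilate ν ν⁻¹ hν (inv_pos.2 hν) v ϖ G' hsw hwg hI
  rw [inv_mul_cancel₀ hν.ne'] at hsw1
  -- and it is RSS with the rotated/dilated profile
  have hAu : ∀ t ∈ Set.Iio (0:ℝ), ∀ x, (ν⁻¹ • stPull ν⁻¹ 1 0 (0 : EuclideanSpace ℝ (Fin 3)) v) t x =
      pvAnsatz α (fun y _ => (Real.sqrt ν)⁻¹ • rotZ (α * Real.log ν)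
        (U (Real.sqrt ν • rotZ (-(α * Real.log ν)) y))) t x := by
    intro t ht x
    rw [smul_stPull_apply, zero_add, zero_add, one_smul]
    exact stub_rssViscosityNormalisation ν α U v hν hA t ht x
  obtain ⟨C, hC, hdec⟩ := finiteAB_rssWitnessDecays_unit hcl hAu hsw1 hwg1 hI1
  refine ⟨C * (Real.sqrt ν + ν), by positivity, ?_⟩
  exact rssWitness_decay_of_normalised hν hdec

end Summit.NavierStokesRegularity.NavierStokesRegularity.Theorems

end
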